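import Summits.RiemannHypothesis.RiemannHypothesis.Theorems.WeilFormatCPolyWindowIncrement
import Summits.RiemannHypothesis.RiemannHypothesis.Theorems.WeilFormatCPolyFourier
import Summits.RiemannHypothesis.RiemannHypothesis.Theorems.WeilFormatCWindowGram
import HarnessLib

/-!
# Format C, design C∞ (L2–V): the mixed increments `D_t(x^j·1_{[−a,a]}, χ_m)` in closed form

Route context: Fourier–Galerkin / Schur-complement certificates of Weil positivity on a window ("format C";
cell memo `run/shared/lean/pub/rh-explicit/rh-explicit-weil-10/FORMATC-DESIGN.md` §9.12.7–§9.12.11, KERNEL-LEVER.md §11–§13;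
supporting stmt-RiemannHypothesis-0098; seat rh-explicit-weil-10).  The deflated certificate of design C∞ couples the
window-polynomial profiles to Yoshida's Fourier block, so besides the profile × profile entries
(`WeilFormatCPolyWindowEntry.lean`) it needs the MIXED entries `weilWindowSesq a (1x^j) (χ_m)`, `1x^j = x^j·1_{[−a,a]}`,
`χ_m(x) = (2a)^{-1/2} e^{iω_m x}·1_{[−a,a]}`, `ω_m = πm/a`.  This file is their increment / prime layer:

* `conj_chiCore`, `integral_pow_mul_conj_chiCore` — `⟨1x^j, χ_m⟩ = (2a)^{-1/2}·c_m(x^j)` with `c_m` the window Fourier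
  coefficient (`Yoshida1992.fourierCoeff`; closed form `fourierCoeff_ofReal_pow_eq_sum`);
* the two shifted overlaps on the window scale as `e^{± iω_m t}` times incomplete Fourier moments
  `∫ y^j e^{−iω_m y} dy` over `[−a+t, a]` resp. `[−a, a−t]` (`integral_shift_pow_mul_conj_chiCore`,
  `conj_integral_chiCore_shift_mul_conj_pow`);
* **`weilIncrementSesq_indicator_pow_chi`** — for `m ≠ 0`, `0 ≤ t ≤ 2a`:
  `D_t(1x^j, χ_m) = (2a)^{-1/2}(−1)^m Σ_{k≤j} (−1)^k j^{(k)}/(−iω_m)^{k+1} ·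
     [a^{j−k}(1 − e^{iω_m t}) − (−a)^{j−k}(1 − e^{−iω_m t}) + (a^{j−k} − (a−t)^{j−k}) + ((t−a)^{j−k} − (−a)^{j−k})]`
  — oscillatory constants times `1 − e^{±iω_m t}` plus a polynomial in `t` vanishing at `0`;
* `weilIncrementSesq_indicator_pow_chi_of_le` (`t ≥ 2a`): `D_t = 2⟨1x^j, χ_m⟩`; the prime block
  `sum_prime_weilIncrementSesq_indicator_pow_chi`; and `chi_zero_eq_smul_indicator_pow_zero` (`χ_0 = (2a)^{-1/2}·1x^0`, so the
  `m = 0` column is the monomial table).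

Pure calculus; standard axioms; no RH claim.
-/

set_option autoImplicit false
-- `Summit.RiemannHypothesis.RiemannHypothesis.…` is the layout-mandated namespace (summit = problem name).
set_option linter.dupNamespace false

noncomputable section

open Complex Filter Set MeasureTheory
open scoped Real Topology ComplexConjugate ArithmeticFunction.vonMangoldt

namespace Summit.RiemannHypothesis.RiemannHypothesis.Theorems.WeilFormatC

open Literature.NumberTheory.LFunctions Literature.NumberTheory.LFunctions.Yoshida1992

variable {a : ℝ}

/-! ## The conjugate basis core and the inner products `⟨1x^j, χ_m⟩` -/

/-- `conj χ_m^{core}(x) = (2a)^{-1/2} e^{−πimx/a}`. -/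
theorem conj_chiCore (a : ℝ) (m : ℤ) (x : ℝ) :
    conj (chiCore a m x) = ((1 / Real.sqrt (2 * a) : ℝ) : ℂ) * cexp (-(π * I * m * x / a)) := by
  simp only [chiCore]
  rw [map_mul, Complex.conj_ofReal, ← Complex.exp_conj]
  congr 2
  simp only [map_div₀, map_mul, Complex.conj_ofReal, Complex.conj_I, map_intCast]
  ring

/-- The exponent `−πimx/a` in the product form `(−iω_m)·x`. -/
theorem neg_freq_exponent_eq (a : ℝ) (m : ℤ) (x : ℝ) :
    (-(π * I * m * x / a) : ℂ) = -(I * (π * m / a : ℝ)) * x := by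
  push_cast
  ring

/-- `χ_m` is the indicator window of its core (definitional). -/
theorem chi_eq_indicator_chiCore (a : ℝ) (m : ℤ) : chi a m = (Icc (-a) a).indicator (chiCore a m) := rfl

/-- **The inner product `⟨1x^j, χ_m⟩`** as a window Fourier coefficient:
`∫_{−a}^{a} x^j conj χ_m^{core}(x) dx = (2a)^{-1/2} c_m(x^j)`, `c_m(φ) = ∫_{−a}^{a} φ(x) e^{−πimx/a} dx`
(closed form for `m ≠ 0`: `WeilFormatCWindowCoeffDecay.fourierCoeff_ofReal_pow_eq_sum`). -/
theorem integral_pow_mul_conj_chiCore (a : ℝ) (m : ℤ) (j : ℕ) :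
    ∫ x in (-a)..a, ((x : ℂ)) ^ j * conj (chiCore a m x) =
      ((1 / Real.sqrt (2 * a) : ℝ) : ℂ) * Yoshida1992.fourierCoeff a m (fun x : ℝ ↦ ((x : ℂ)) ^ j) := by
  unfold Yoshida1992.fourierCoeff
  rw [← intervalIntegral.integral_const_mul]
  refine intervalIntegral.integral_congr fun x _ ↦ ?_
  simp only [conj_chiCore]
  ring

/-- `∫_ℝ (1x^j) conj χ_m = (2a)^{-1/2} c_m(x^j)` (`a ≥ 0`). -/
theorem integral_indicator_pow_mul_conj_chi (ha : 0 ≤ a) (m : ℤ) (j : ℕ) :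
    ∫ x, (Icc (-a) a).indicator (fun x : ℝ ↦ ((x : ℂ)) ^ j) x * conj (chi a m x) =
      ((1 / Real.sqrt (2 * a) : ℝ) : ℂ) * Yoshida1992.fourierCoeff a m (fun x : ℝ ↦ ((x : ℂ)) ^ j) := by
  rw [chi_eq_indicator_chiCore, integral_indicator_mul_conj_indicator ha, integral_pow_mul_conj_chiCore]

/-! ## Endpoint exponentials -/

/-- `e^{(−iω_m)·a} = (−1)^m`. -/
theorem cexp_neg_freq_mul_self (ha : a ≠ 0) (m : ℤ) :
    cexp (-(I * (π * m / a : ℝ)) * a) = (-1 : ℂ) ^ m := by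
  rw [show (-(I * (π * m / a : ℝ)) * a : ℂ) = I * (π * m / a : ℝ) * (((-a : ℝ)) : ℂ) by push_cast; ring]
  exact cexp_I_mul_freq_mul_neg_self ha m

/-- `e^{(−iω_m)·(−a)} = (−1)^m`. -/
theorem cexp_neg_freq_mul_neg_self (ha : a ≠ 0) (m : ℤ) :
    cexp (-(I * (π * m / a : ℝ)) * (((-a : ℝ)) : ℂ)) = (-1 : ℂ) ^ m := by
  rw [show (-(I * (π * m / a : ℝ)) * (((-a : ℝ)) : ℂ) : ℂ) = I * (π * m / a : ℝ) * a by push_cast; ring]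
  exact cexp_I_mul_freq_mul_self ha m

/-- `e^{(−iω_m)(−a+t)} = (−1)^m e^{−iω_m t}`. -/
theorem cexp_neg_freq_mul_neg_add (ha : a ≠ 0) (m : ℤ) (t : ℝ) :
    cexp (-(I * (π * m / a : ℝ)) * (((-a + t : ℝ)) : ℂ)) = (-1 : ℂ) ^ m * cexp (-(I * (π * m / a : ℝ) * t)) := by
  rw [show (-(I * (π * m / a : ℝ)) * (((-a + t : ℝ)) : ℂ) : ℂ) =
      -(I * (π * m / a : ℝ)) * (((-a : ℝ)) : ℂ) + -(I * (π * m / a : ℝ) * t) by push_cast; ring,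
    Complex.exp_add, cexp_neg_freq_mul_neg_self ha]

/-- `e^{(−iω_m)(a−t)} = (−1)^m e^{iω_m t}`. -/
theorem cexp_neg_freq_mul_sub (ha : a ≠ 0) (m : ℤ) (t : ℝ) :
    cexp (-(I * (π * m / a : ℝ)) * (((a - t : ℝ)) : ℂ)) = (-1 : ℂ) ^ m * cexp (I * (π * m / a : ℝ) * t) := by
  rw [show (-(I * (π * m / a : ℝ)) * (((a - t : ℝ)) : ℂ) : ℂ) =
      -(I * (π * m / a : ℝ)) * a + I * (π * m / a : ℝ) * t by push_cast; ring,
    Complex.exp_add, cexp_neg_freq_mul_self ha]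

/-- `e^{iω_m t} e^{−iω_m t} = 1`. -/
theorem cexp_freq_mul_cexp_neg_freq (a : ℝ) (m : ℤ) (t : ℝ) :
    cexp (I * (π * m / a : ℝ) * t) * cexp (-(I * (π * m / a : ℝ) * t)) = 1 := by
  rw [← Complex.exp_add, add_neg_cancel, Complex.exp_zero]

/-! ## The incomplete Fourier moments and the two shifted overlaps -/

/-- **Incomplete Fourier moment, closed form** (`a ≠ 0`, `m ≠ 0`): for real endpoints `s, e`,
`∫_s^e y^j e^{−iω_m y} dy = Σ_{k≤j} (−1)^k j^{(k)} (e^{j−k} e^{−iω_m e} − s^{j−k} e^{−iω_m s}) / (−iω_m)^{k+1}`. -/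
theorem integral_pow_mul_cexp_neg_freq_eq_sum (ha : a ≠ 0) {m : ℤ} (hm : m ≠ 0) (j : ℕ) (s e : ℝ) :
    ∫ y in s..e, ((y : ℂ)) ^ j * cexp (-(I * (π * m / a : ℝ)) * y) =
      ∑ k ∈ Finset.range (j + 1), (-1 : ℂ) ^ k * (j.descFactorial k : ℂ) *
        (((e : ℂ)) ^ (j - k) * cexp (-(I * (π * m / a : ℝ)) * e) -
          ((s : ℂ)) ^ (j - k) * cexp (-(I * (π * m / a : ℝ)) * s)) / (-(I * (π * m / a : ℝ))) ^ (k + 1) := by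
  have hc : (-(I * (π * m / a : ℝ)) : ℂ) ≠ 0 := by
    apply neg_ne_zero.2 (mul_ne_zero I_ne_zero ?_)
    exact_mod_cast (div_ne_zero (mul_ne_zero Real.pi_ne_zero (Int.cast_ne_zero.mpr hm)) ha)
  exact integral_pow_mul_cexp_eq_sum hc j s e

/-- **The Fourier coefficient of a monomial through the incomplete moment at full range**:
`∫_{−a}^{a} x^j conj χ_m^{core} = (2a)^{-1/2} ∫_{−a}^{a} y^j e^{−iω_m y} dy`. -/
theorem integral_pow_mul_conj_chiCore_eq (a : ℝ) (m : ℤ) (j : ℕ) :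
    ∫ x in (-a)..a, ((x : ℂ)) ^ j * conj (chiCore a m x) =
      ((1 / Real.sqrt (2 * a) : ℝ) : ℂ) * ∫ y in (-a)..a, ((y : ℂ)) ^ j * cexp (-(I * (π * m / a : ℝ)) * y) := by
  rw [← intervalIntegral.integral_const_mul]
  refine intervalIntegral.integral_congr fun x _ ↦ ?_
  simp only [conj_chiCore, neg_freq_exponent_eq]
  ring

/-- **First shifted overlap**: `∫_{−a}^{a−t} (x+t)^j conj χ_m^{core}(x) dx = (2a)^{-1/2} e^{iω_m t} ∫_{−a+t}^{a} y^j e^{−iω_m y} dy`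
(substitution `y = x + t`). -/
theorem integral_shift_pow_mul_conj_chiCore (a : ℝ) (m : ℤ) (j : ℕ) (t : ℝ) :
    ∫ x in (-a)..(a - t), (((x + t : ℝ)) : ℂ) ^ j * conj (chiCore a m x) =
      ((1 / Real.sqrt (2 * a) : ℝ) : ℂ) * cexp (I * (π * m / a : ℝ) * t) *
        ∫ y in (-a + t)..a, ((y : ℂ)) ^ j * cexp (-(I * (π * m / a : ℝ)) * y) := by
  have hsub := intervalIntegral.integral_comp_add_right (a := -a) (b := a - t)
    (fun y : ℝ ↦ ((y : ℂ)) ^ j * cexp (-(I * (π * m / a : ℝ)) * y)) t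
  rw [sub_add_cancel] at hsub
  rw [← hsub, ← intervalIntegral.integral_const_mul]
  refine intervalIntegral.integral_congr fun x _ ↦ ?_
  simp only [conj_chiCore]
  rw [show (-(π * I * m * x / a) : ℂ) = I * (π * m / a : ℝ) * t + -(I * (π * m / a : ℝ)) * (((x + t : ℝ)) : ℂ) by
    push_cast; ring, Complex.exp_add]
  ring

/-- **Second shifted overlap, conjugated** (`t ≤ 2a`):
`conj ∫_{−a}^{a−t} χ_m^{core}(x+t) conj(x^j) dx = (2a)^{-1/2} e^{−iω_m t} ∫_{−a}^{a−t} y^j e^{−iω_m y} dy`. -/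
theorem conj_integral_chiCore_shift_mul_conj_pow (a : ℝ) (m : ℤ) (j : ℕ) {t : ℝ} (ht : t ≤ 2 * a) :
    conj (∫ x in (-a)..(a - t), chiCore a m (x + t) * conj (((x : ℂ)) ^ j)) =
      ((1 / Real.sqrt (2 * a) : ℝ) : ℂ) * cexp (-(I * (π * m / a : ℝ) * t)) *
        ∫ y in (-a)..(a - t), ((y : ℂ)) ^ j * cexp (-(I * (π * m / a : ℝ)) * y) := by
  have hle : -a ≤ a - t := by linarith
  rw [intervalIntegral.integral_of_le hle, intervalIntegral.integral_of_le hle, ← integral_conj,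
    ← integral_const_mul]
  refine setIntegral_congr_fun measurableSet_Ioc fun x _ ↦ ?_
  simp only [map_mul, Complex.conj_conj, conj_chiCore]
  rw [show (-(π * I * m * (((x + t : ℝ)) : ℂ) / a) : ℂ) = -(I * (π * m / a : ℝ) * t) + -(I * (π * m / a : ℝ)) * x by
    push_cast; ring, Complex.exp_add]
  ring

/-! ## The mixed increment pairing in closed form -/

/-- **The mixed increment pairing on the window scale** (`a > 0`, `m ≠ 0`, `0 ≤ t ≤ 2a`):
`D_t(1x^j, χ_m) = (2a)^{-1/2}(−1)^m Σ_{k≤j} (−1)^k j^{(k)}/(−iω_m)^{k+1} · [a^{j−k}(1 − e^{iω_m t}) − (−a)^{j−k}(1 − e^{−iω_m t})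
  + (a^{j−k} − (a−t)^{j−k}) + ((t−a)^{j−k} − (−a)^{j−k})]`. -/
theorem weilIncrementSesq_indicator_pow_chi (ha : 0 < a) {m : ℤ} (hm : m ≠ 0) (j : ℕ) {t : ℝ} (ht0 : 0 ≤ t)
    (ht : t ≤ 2 * a) :
    weilIncrementSesq ((Icc (-a) a).indicator fun x : ℝ ↦ ((x : ℂ)) ^ j) (chi a m) t =
      ((1 / Real.sqrt (2 * a) : ℝ) : ℂ) * (-1 : ℂ) ^ m *
        ∑ k ∈ Finset.range (j + 1), (-1 : ℂ) ^ k * (j.descFactorial k : ℂ) / (-(I * (π * m / a : ℝ))) ^ (k + 1) *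
          (((a : ℂ)) ^ (j - k) * (1 - cexp (I * (π * m / a : ℝ) * t))
            - (((-a : ℝ)) : ℂ) ^ (j - k) * (1 - cexp (-(I * (π * m / a : ℝ) * t)))
            + (((a : ℂ)) ^ (j - k) - (((a - t : ℝ)) : ℂ) ^ (j - k))
            + ((((-a + t : ℝ)) : ℂ) ^ (j - k) - (((-a : ℝ)) : ℂ) ^ (j - k))) := by
  have ha' : a ≠ 0 := ha.ne'
  have hchi : IsWindowFunction a ((Icc (-a) a).indicator (chiCore a m)) := isWindowFunction_chi ha m
  rw [chi_eq_indicator_chiCore, weilIncrementSesq_indicator (isWindowFunction_indicator_pow a j) hchi ht0 ht,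
    integral_pow_mul_conj_chiCore_eq, integral_shift_pow_mul_conj_chiCore,
    conj_integral_chiCore_shift_mul_conj_pow a m j ht,
    integral_pow_mul_cexp_neg_freq_eq_sum ha' hm, integral_pow_mul_cexp_neg_freq_eq_sum ha' hm,
    integral_pow_mul_cexp_neg_freq_eq_sum ha' hm,
    cexp_neg_freq_mul_self ha', cexp_neg_freq_mul_neg_self ha', cexp_neg_freq_mul_neg_add ha',
    cexp_neg_freq_mul_sub ha']
  have hEE := cexp_freq_mul_cexp_neg_freq a m t
  set E := cexp (I * (π * m / a : ℝ) * t) with hE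
  set E' := cexp (-(I * (π * m / a : ℝ) * t)) with hE'
  set N := ((1 / Real.sqrt (2 * a) : ℝ) : ℂ) with hN
  set c := (-(I * (π * m / a : ℝ)) : ℂ) with hc
  rw [Finset.mul_sum, Finset.mul_sum, Finset.mul_sum, Finset.mul_sum, Finset.mul_sum, ← Finset.sum_sub_distrib,
    ← Finset.sum_sub_distrib]
  refine Finset.sum_congr rfl fun k _ ↦ ?_
  have hck : c ^ (k + 1) ≠ 0 := by
    apply pow_ne_zero
    rw [hc]
    apply neg_ne_zero.2 (mul_ne_zero I_ne_zero ?_)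
    exact_mod_cast (div_ne_zero (mul_ne_zero Real.pi_ne_zero (Int.cast_ne_zero.mpr hm)) ha')
  field_simp
  linear_combination (N * (j.descFactorial k : ℂ) *
    ((((-a + t : ℝ)) : ℂ) ^ (j - k) - (((a - t : ℝ)) : ℂ) ^ (j - k))) * hEE

/-- **The mixed increment pairing beyond the window scale** (`a > 0`, `t ≥ 2a`): `D_t(1x^j, χ_m) = 2⟨1x^j, χ_m⟩
= 2(2a)^{-1/2} c_m(x^j)`. -/
theorem weilIncrementSesq_indicator_pow_chi_of_le (ha : 0 < a) (m : ℤ) (j : ℕ) {t : ℝ} (ht : 2 * a ≤ t) :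
    weilIncrementSesq ((Icc (-a) a).indicator fun x : ℝ ↦ ((x : ℂ)) ^ j) (chi a m) t =
      2 * (((1 / Real.sqrt (2 * a) : ℝ) : ℂ) * Yoshida1992.fourierCoeff a m (fun x : ℝ ↦ ((x : ℂ)) ^ j)) := by
  have hchi : IsWindowFunction a ((Icc (-a) a).indicator (chiCore a m)) := isWindowFunction_chi ha m
  rw [chi_eq_indicator_chiCore, weilIncrementSesq_indicator_of_le ha.le (isWindowFunction_indicator_pow a j) hchi ht,
    integral_pow_mul_conj_chiCore]

/-- **The mixed prime block** (`a > 0`, `m ≠ 0`): the prime lengths `log n < 2a` lie on the window scale, so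
`Σ_{log n<2a} Λ(n) n^{-1/2} D_{log n}(1x^j, χ_m)` is the sum of the closed forms of `weilIncrementSesq_indicator_pow_chi` at
`t = log n`. -/
theorem sum_prime_weilIncrementSesq_indicator_pow_chi (ha : 0 < a) {m : ℤ} (hm : m ≠ 0) (j : ℕ) :
    ∑ n ∈ weilPrimeIndex a, ((Λ n : ℝ) / Real.sqrt n : ℂ) *
        weilIncrementSesq ((Icc (-a) a).indicator fun x : ℝ ↦ ((x : ℂ)) ^ j) (chi a m) (Real.log n) =
      ∑ n ∈ weilPrimeIndex a, ((Λ n : ℝ) / Real.sqrt n : ℂ) *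
        (((1 / Real.sqrt (2 * a) : ℝ) : ℂ) * (-1 : ℂ) ^ m *
          ∑ k ∈ Finset.range (j + 1), (-1 : ℂ) ^ k * (j.descFactorial k : ℂ) / (-(I * (π * m / a : ℝ))) ^ (k + 1) *
            (((a : ℂ)) ^ (j - k) * (1 - cexp (I * (π * m / a : ℝ) * (Real.log n : ℝ)))
              - (((-a : ℝ)) : ℂ) ^ (j - k) * (1 - cexp (-(I * (π * m / a : ℝ) * (Real.log n : ℝ))))
              + (((a : ℂ)) ^ (j - k) - (((a - Real.log n : ℝ)) : ℂ) ^ (j - k))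
              + ((((-a + Real.log n : ℝ)) : ℂ) ^ (j - k) - (((-a : ℝ)) : ℂ) ^ (j - k)))) := by
  refine Finset.sum_congr rfl fun n hn ↦ ?_
  have hlt : Real.log n < 2 * a := mem_weilPrimeIndex.1 hn
  rw [weilIncrementSesq_indicator_pow_chi ha hm j (Real.log_natCast_nonneg n) hlt.le]

/-! ## The zero mode -/

/-- `χ_0 = (2a)^{-1/2} · 1x^0`: the `m = 0` column of the mixed table is the monomial table (up to the factor). -/
theorem chi_zero_eq_smul_indicator_pow_zero (a : ℝ) :
    chi a 0 = ((1 / Real.sqrt (2 * a) : ℝ) : ℂ) • (Icc (-a) a).indicator (fun x : ℝ ↦ ((x : ℂ)) ^ (0 : ℕ)) := by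
  funext x
  rw [chi_eq_indicator_chiCore, Pi.smul_apply, smul_eq_mul]
  by_cases hx : x ∈ Icc (-a) a
  · rw [indicator_of_mem hx, indicator_of_mem hx, chiCore]
    simp
  · rw [indicator_of_notMem hx, indicator_of_notMem hx, mul_zero]

/-- **The `m = 0` mixed entries from the monomial table**: `W_a(u, χ_0) = (2a)^{-1/2} W_a(u, 1x^0)` for every `u`. -/
theorem weilWindowSesq_chi_zero_right (a : ℝ) (u : ℝ → ℂ) :
    weilWindowSesq a u (chi a 0) =
      ((1 / Real.sqrt (2 * a) : ℝ) : ℂ) * weilWindowSesq a u ((Icc (-a) a).indicator fun x : ℝ ↦ ((x : ℂ)) ^ (0 : ℕ)) := by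
  rw [chi_zero_eq_smul_indicator_pow_zero, weilWindowSesq_smul_right, Complex.conj_ofReal]

/-- `W_a(χ_0, v) = (2a)^{-1/2} W_a(1x^0, v)` for every `v`. -/
theorem weilWindowSesq_chi_zero_left (a : ℝ) (v : ℝ → ℂ) :
    weilWindowSesq a (chi a 0) v =
      ((1 / Real.sqrt (2 * a) : ℝ) : ℂ) * weilWindowSesq a ((Icc (-a) a).indicator fun x : ℝ ↦ ((x : ℂ)) ^ (0 : ℕ)) v := by
  rw [chi_zero_eq_smul_indicator_pow_zero, weilWindowSesq_smul_left]

end Summit.RiemannHypothesis.RiemannHypothesis.Theorems.WeilFormatC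

end
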